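import Literature.MathematicalPhysics.QuantumManyBody.BoseEinsteinCondensation

/-!
# `BoundaryTransferWeak` (stmt-AtomisticToContinuum-0827), line `mode_free_reward`, stub `stub_gapScaleChord`:
# the gap-scale two-chord bound IS a no-over-condensation window statement (conditional reduction)

Supports (does not close) stmt-AtomisticToContinuum-0827, piece X₁ `ModeFreeRewardChord` of the mode-free
reward split, GAP-SCALE stub `stub_gapScaleChord` of the lead's skeleton (`TwoChord λ (κ/L_N²) τ` for all
`0 < λ ≤ κ/L_N²`). With the mode-free rewarded infimum

  `G(t) = ⨅ Ψ, energy v Ψ + t (N − λ_max(γ_Ψ))`   (`λ_max = maxOccupation`)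

and the two-chord inequality `G(a) + (a/b) E₀ ≤ E₀ + (a/b) G(b) + a τ N` (both RESTATED BY THEIR BODIES
below; the skeleton's `def G` / `def TwoChord` are not landed), this file proves, at FIXED `N, L` and by pure
`ℝ≥0∞` variational algebra:

* `le_iInf_modeFree_of_window` — if every trial state in the energy window `E ≤ E₀ + bN` has
  `λ_max ≤ n + τN` (NO OVER-CONDENSATION in the window of `b` per particle), then `G(b) ≥ E₀ + b (N − (n + τN))`;
* `iInf_modeFree_le_of_near` — if `n` is asymptotically attained from below by `λ_max` along a minimising
  sequence, then `G(a) ≤ E₀ + a (N − n)` for every `a ≥ 0`;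
* `twoChord_of_noOvercondensation` — together: `TwoChord a b τ` for all `0 < a ≤ b`;
* `noOvercondensation_of_twoChord` — conversely `TwoChord a b τ` plus `λ_max ≤ m` on the window `E ≤ E₀ + aN`
  force `λ_max ≤ m + (σ + τ)N` on the window `E ≤ E₀ + σ b N` (so the two formulations are equivalent);
* `gapScaleChord_of_noOvercondensation` — the eventually-in-`N` form along `L_N = sideLength ρ N` with
  `b = κ/L_N²`, concluding VERBATIM the body of `stub_gapScaleChord` for the given `v`.

So the gap-scale stub follows from (and, up to halving `τ` and shrinking `κ`, is equivalent to) the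
thermodynamic-limit statement "eventually in `N`, no Dirichlet trial state within `κ(τ) N/L_N²` of `E₀^D`
is more condensed than the ground state by `τN`" — an UPPER window bound on `λ_max`, which holds at `v = 0`
(`λ_max ≤ N = λ_max(∏ sin)`), is not touched by the tree's cat-state window negatives (those bound `λ_max`
from below), and is open for interacting `v` (it asserts that re-condensing a fraction `τ` of the quantum
depletion costs more than `κ/L_N²` per particle, uniformly in `N`). No spectral gap or variance hypothesis
is used or would suffice: at reward `κ/L_N²` the perturbative parameter `κ·SD_{Ψ₀}(n̂_φ)/g₀` diverges with `N`.
-/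

noncomputable section

open MeasureTheory Filter
open scoped ENNReal NNReal Topology

namespace Summit.AtomisticToContinuum.BoseEinsteinCondensation.ModeFreeReward

open Literature.MathematicalPhysics.QuantumManyBody.BoseGas

variable {v : ℝ → ℝ≥0∞} {N : ℕ} {L : ℝ}

/-- **Lower chord bound from a no-over-condensation window** (fixed `N, L`): if every trial state with
`energy ≤ E₀ + bN` has `λ_max ≤ n + τN`, then `E₀ + b (N − (n + τN)) ≤ G(b)`. States outside the window pay
`≥ bN ≥ b (N − (n + τN))` in energy alone. [folklore] -/
theorem le_iInf_modeFree_of_window {b τ : ℝ} (n : ℝ≥0∞)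
    (hwin : ∀ Ψ : TrialState N L,
      energy v Ψ ≤ groundStateEnergy v N L + ENNReal.ofReal b * N →
        maxOccupation N Ψ.ψ ≤ n + ENNReal.ofReal (τ * N)) :
    groundStateEnergy v N L + ENNReal.ofReal b * ((N : ℝ≥0∞) - (n + ENNReal.ofReal (τ * N))) ≤
      ⨅ Ψ : TrialState N L, energy v Ψ + ENNReal.ofReal b * ((N : ℝ≥0∞) - maxOccupation N Ψ.ψ) := by
  refine le_iInf fun Ψ => ?_
  by_cases h : energy v Ψ ≤ groundStateEnergy v N L + ENNReal.ofReal b * N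
  · have hmono : (N : ℝ≥0∞) - (n + ENNReal.ofReal (τ * N)) ≤ (N : ℝ≥0∞) - maxOccupation N Ψ.ψ :=
      tsub_le_tsub_left (hwin Ψ h) _
    exact add_le_add (groundStateEnergy_le_energy v Ψ) (mul_le_mul_right hmono _)
  · have h' : groundStateEnergy v N L + ENNReal.ofReal b * N ≤ energy v Ψ := (lt_of_not_ge h).le
    calc groundStateEnergy v N L + ENNReal.ofReal b * ((N : ℝ≥0∞) - (n + ENNReal.ofReal (τ * N)))
        ≤ groundStateEnergy v N L + ENNReal.ofReal b * N :=
          add_le_add le_rfl (mul_le_mul_right tsub_le_self _)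
      _ ≤ energy v Ψ := h'
      _ ≤ energy v Ψ + ENNReal.ofReal b * ((N : ℝ≥0∞) - maxOccupation N Ψ.ψ) := le_self_add

/-- **Upper chord bound from near-minimisers** (fixed `N, L`): if for every slack `δ > 0` some `δ`-near-minimiser
has `λ_max ≥ n − δ`, then `G(a) ≤ E₀ + a (N − n)` for every `a ≥ 0`. [folklore] -/
theorem iInf_modeFree_le_of_near {a : ℝ} (n : ℝ≥0∞)
    (hnear : ∀ δ : ℝ≥0∞, 0 < δ → ∃ Ψ : TrialState N L,
      energy v Ψ ≤ groundStateEnergy v N L + δ ∧ n ≤ maxOccupation N Ψ.ψ + δ) :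
    (⨅ Ψ : TrialState N L, energy v Ψ + ENNReal.ofReal a * ((N : ℝ≥0∞) - maxOccupation N Ψ.ψ)) ≤
      groundStateEnergy v N L + ENNReal.ofReal a * ((N : ℝ≥0∞) - n) := by
  refine ENNReal.le_of_forall_pos_le_add fun ε hε _ => ?_
  -- slack `δ = ε / (1 + a)`, so that `δ (1 + a) = ε`
  have h1a : (1 : ℝ≥0∞) + ENNReal.ofReal a ≠ 0 := by positivity
  have h1a' : (1 : ℝ≥0∞) + ENNReal.ofReal a ≠ ⊤ := by finiteness
  set δ : ℝ≥0∞ := (ε : ℝ≥0∞) / (1 + ENNReal.ofReal a) with hδ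
  have hδpos : 0 < δ := ENNReal.div_pos (by exact_mod_cast hε.ne') h1a'
  have hδε : δ * (1 + ENNReal.ofReal a) = ε := ENNReal.div_mul_cancel h1a h1a'
  obtain ⟨Ψ, hE, hn⟩ := hnear δ hδpos
  have hsub : (N : ℝ≥0∞) - maxOccupation N Ψ.ψ ≤ (N : ℝ≥0∞) - n + δ :=
    (tsub_le_tsub_left (tsub_le_iff_right.2 hn) _).trans tsub_tsub_le_tsub_add
  calc (⨅ Ψ : TrialState N L, energy v Ψ + ENNReal.ofReal a * ((N : ℝ≥0∞) - maxOccupation N Ψ.ψ))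
      ≤ energy v Ψ + ENNReal.ofReal a * ((N : ℝ≥0∞) - maxOccupation N Ψ.ψ) := iInf_le _ Ψ
    _ ≤ groundStateEnergy v N L + δ + ENNReal.ofReal a * ((N : ℝ≥0∞) - n + δ) := by gcongr
    _ = groundStateEnergy v N L + ENNReal.ofReal a * ((N : ℝ≥0∞) - n) +
          δ * (1 + ENNReal.ofReal a) := by ring
    _ = groundStateEnergy v N L + ENNReal.ofReal a * ((N : ℝ≥0∞) - n) + ε := by rw [hδε]

/-- **The two-chord bound from a no-over-condensation window** (fixed `N, L`; `0 < a ≤ b`; any `τ`): if `n` is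
asymptotically attained by `λ_max` along a minimising sequence and no trial state in the window `E ≤ E₀ + bN`
has `λ_max > n + τN`, then `G(a) + (a/b) E₀ ≤ E₀ + (a/b) G(b) + a τ N`. [folklore] -/
theorem twoChord_of_noOvercondensation {a b τ : ℝ} (n : ℝ≥0∞) (ha : 0 < a) (hab : a ≤ b)
    (hnear : ∀ δ : ℝ≥0∞, 0 < δ → ∃ Ψ : TrialState N L,
      energy v Ψ ≤ groundStateEnergy v N L + δ ∧ n ≤ maxOccupation N Ψ.ψ + δ)
    (hwin : ∀ Ψ : TrialState N L,
      energy v Ψ ≤ groundStateEnergy v N L + ENNReal.ofReal b * N →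
        maxOccupation N Ψ.ψ ≤ n + ENNReal.ofReal (τ * N)) :
    (⨅ Ψ : TrialState N L, energy v Ψ + ENNReal.ofReal a * ((N : ℝ≥0∞) - maxOccupation N Ψ.ψ)) +
        ENNReal.ofReal (a / b) * groundStateEnergy v N L ≤
      groundStateEnergy v N L +
          ENNReal.ofReal (a / b) *
            (⨅ Ψ : TrialState N L, energy v Ψ + ENNReal.ofReal b * ((N : ℝ≥0∞) - maxOccupation N Ψ.ψ)) +
        ENNReal.ofReal (a * τ * N) := by
  have hb : 0 < b := ha.trans_le hab
  set E := groundStateEnergy v N L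
  set A := ENNReal.ofReal a
  set B := ENNReal.ofReal b
  set r := ENNReal.ofReal (a / b)
  set T := ENNReal.ofReal (τ * N)
  have h1 := iInf_modeFree_le_of_near (v := v) (a := a) n hnear
  have h2 := le_iInf_modeFree_of_window (v := v) n hwin
  have hrB : r * B = A := by
    rw [← ENNReal.ofReal_mul (div_nonneg ha.le hb.le), div_mul_cancel₀ a hb.ne']
  have hAT : ENNReal.ofReal (a * τ * N) = A * T := by
    rw [mul_assoc, ENNReal.ofReal_mul ha.le]
  have hsub : (N : ℝ≥0∞) - n ≤ (N : ℝ≥0∞) - (n + T) + T :=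
    le_tsub_add.trans_eq (by rw [tsub_tsub])
  calc (⨅ Ψ : TrialState N L, energy v Ψ + A * ((N : ℝ≥0∞) - maxOccupation N Ψ.ψ)) + r * E
      ≤ E + A * ((N : ℝ≥0∞) - n) + r * E := by gcongr
    _ ≤ E + A * ((N : ℝ≥0∞) - (n + T) + T) + r * E := by gcongr
    _ = E + r * (E + B * ((N : ℝ≥0∞) - (n + T))) + r * B * T := by rw [← hrB]; ring
    _ ≤ E + r * (⨅ Ψ : TrialState N L, energy v Ψ + B * ((N : ℝ≥0∞) - maxOccupation N Ψ.ψ)) +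
          ENNReal.ofReal (a * τ * N) := by rw [hAT, hrB]; gcongr

/-- **Converse: the two-chord bound forbids over-condensation** (fixed `N, L`, `E₀ < ∞`): if the two-chord
inequality holds between some `0 < a ≤ b` with tolerance `τ ≥ 0`, and `λ_max ≤ m` on the window `E ≤ E₀ + aN`,
then every trial state within `σ b N` of `E₀` (`σ ≥ 0`) with `λ_max ≤ N` has `λ_max ≤ m + (σ + τ) N`. As `a ↓ 0`
the admissible `m` decrease to the level `n₀⁺ = inf_δ sup {λ_max(Ψ) : E(Ψ) ≤ E₀ + δ}` attained along minimising
sequences, so together with `twoChord_of_noOvercondensation` the gap-scale chord bound (`∀ τ ∃ κ`) and the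
no-over-condensation window (`∀ τ ∃ κ`) are equivalent. [folklore] -/
theorem noOvercondensation_of_twoChord {a b τ σ : ℝ} (m : ℝ≥0∞) (ha : 0 < a) (hab : a ≤ b) (hτ : 0 ≤ τ)
    (hσ : 0 ≤ σ) (hE : groundStateEnergy v N L ≠ ⊤)
    (hchord : (⨅ Ψ : TrialState N L, energy v Ψ + ENNReal.ofReal a * ((N : ℝ≥0∞) - maxOccupation N Ψ.ψ)) +
        ENNReal.ofReal (a / b) * groundStateEnergy v N L ≤
      groundStateEnergy v N L +
          ENNReal.ofReal (a / b) *
            (⨅ Ψ : TrialState N L, energy v Ψ + ENNReal.ofReal b * ((N : ℝ≥0∞) - maxOccupation N Ψ.ψ)) +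
        ENNReal.ofReal (a * τ * N))
    (hcap : ∀ Φ : TrialState N L,
      energy v Φ ≤ groundStateEnergy v N L + ENNReal.ofReal a * N → maxOccupation N Φ.ψ ≤ m)
    (Ψ : TrialState N L) (hΨ : energy v Ψ ≤ groundStateEnergy v N L + ENNReal.ofReal (σ * b) * N)
    (hΨN : maxOccupation N Ψ.ψ ≤ N) :
    maxOccupation N Ψ.ψ ≤ m + ENNReal.ofReal ((σ + τ) * N) := by
  have hb : 0 < b := ha.trans_le hab
  have hS : ENNReal.ofReal σ * N + ENNReal.ofReal (τ * N) = ENNReal.ofReal ((σ + τ) * N) := by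
    rw [← ENNReal.ofReal_natCast N, ← ENNReal.ofReal_mul hσ, add_mul,
      ENNReal.ofReal_add (by positivity) (by positivity)]
  set E := groundStateEnergy v N L
  set A := ENNReal.ofReal a
  set B := ENNReal.ofReal b
  set r := ENNReal.ofReal (a / b)
  set T := ENNReal.ofReal (τ * N)
  set S := ENNReal.ofReal ((σ + τ) * N)
  -- the two one-sided chord bounds
  have hlow : E + A * ((N : ℝ≥0∞) - m) ≤
      ⨅ Ψ : TrialState N L, energy v Ψ + A * ((N : ℝ≥0∞) - maxOccupation N Ψ.ψ) := by
    have h := le_iInf_modeFree_of_window (v := v) (b := a) (τ := 0) m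
      (fun Φ hΦ => (hcap Φ hΦ).trans le_self_add)
    simpa only [zero_mul, ENNReal.ofReal_zero, add_zero] using h
  have hup : (⨅ Ψ : TrialState N L, energy v Ψ + B * ((N : ℝ≥0∞) - maxOccupation N Ψ.ψ)) ≤
      E + ENNReal.ofReal (σ * b) * N + B * ((N : ℝ≥0∞) - maxOccupation N Ψ.ψ) :=
    (iInf_le _ Ψ).trans (add_le_add hΨ le_rfl)
  -- algebraic identities
  have hrB : r * B = A := by
    rw [← ENNReal.ofReal_mul (div_nonneg ha.le hb.le), div_mul_cancel₀ a hb.ne']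
  have hAT : ENNReal.ofReal (a * τ * N) = A * T := by
    rw [mul_assoc, ENNReal.ofReal_mul ha.le]
  have hσB : ENNReal.ofReal (σ * b) = ENNReal.ofReal σ * B := ENNReal.ofReal_mul hσ
  -- chain the chord inequality between the two one-sided bounds
  have key1 : E + r * E + A * ((N : ℝ≥0∞) - m) ≤
      E + r * E + A * (ENNReal.ofReal σ * N + ((N : ℝ≥0∞) - maxOccupation N Ψ.ψ) + T) :=
    calc E + r * E + A * ((N : ℝ≥0∞) - m) = E + A * ((N : ℝ≥0∞) - m) + r * E := by ring
      _ ≤ (⨅ Ψ : TrialState N L, energy v Ψ + A * ((N : ℝ≥0∞) - maxOccupation N Ψ.ψ)) + r * E :=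
          add_le_add hlow le_rfl
      _ ≤ E + r * (⨅ Ψ : TrialState N L, energy v Ψ + B * ((N : ℝ≥0∞) - maxOccupation N Ψ.ψ)) +
            ENNReal.ofReal (a * τ * N) := hchord
      _ ≤ E + r * (E + ENNReal.ofReal (σ * b) * N + B * ((N : ℝ≥0∞) - maxOccupation N Ψ.ψ)) +
            ENNReal.ofReal (a * τ * N) := add_le_add (add_le_add le_rfl (mul_le_mul_right hup _)) le_rfl
      _ = E + r * E + A * (ENNReal.ofReal σ * N + ((N : ℝ≥0∞) - maxOccupation N Ψ.ψ) + T) := by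
          rw [hAT, hσB, ← hrB]; ring
  have hfin : E + r * E ≠ ⊤ := by finiteness
  have hA0 : A ≠ 0 := (ENNReal.ofReal_pos.2 ha).ne'
  have key2 : (N : ℝ≥0∞) - m ≤ ((N : ℝ≥0∞) - maxOccupation N Ψ.ψ) + S := by
    have h := (ENNReal.mul_le_mul_iff_right hA0 ENNReal.ofReal_ne_top).1
      ((ENNReal.add_le_add_iff_left hfin).1 key1)
    calc (N : ℝ≥0∞) - m ≤ ENNReal.ofReal σ * N + ((N : ℝ≥0∞) - maxOccupation N Ψ.ψ) + T := h
      _ = ((N : ℝ≥0∞) - maxOccupation N Ψ.ψ) + (ENNReal.ofReal σ * N + T) := by ring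
      _ = ((N : ℝ≥0∞) - maxOccupation N Ψ.ψ) + S := by rw [hS]
  -- unwind the deficiencies
  calc maxOccupation N Ψ.ψ = (N : ℝ≥0∞) - ((N : ℝ≥0∞) - maxOccupation N Ψ.ψ) :=
        (ENNReal.sub_sub_cancel (ENNReal.natCast_ne_top N) hΨN).symm
    _ ≤ (N : ℝ≥0∞) - ((N : ℝ≥0∞) - m - S) := tsub_le_tsub_left (tsub_le_iff_right.2 key2) _
    _ ≤ (N : ℝ≥0∞) - ((N : ℝ≥0∞) - m) + S := tsub_tsub_le_tsub_add
    _ ≤ m + S := add_le_add tsub_tsub_le le_rfl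

/-- **`stub_gapScaleChord` from no over-condensation at the gap scale** (the reduction, for a fixed potential `v`):
if below some density, for every `τ > 0` there is `κ > 0` such that eventually in `N` (whenever `E₀^D < ∞`) some
level `n` is asymptotically attained by `λ_max` along a Dirichlet minimising sequence while NO trial state within
`(κ/L_N²)·N` of `E₀^D` has `λ_max > n + τN`, then the gap-scale two-chord bound of the skeleton holds verbatim:
`TwoChord λ (κ/L_N²) τ` for all `0 < λ ≤ κ/L_N²`, eventually in `N`. [folklore] -/
theorem gapScaleChord_of_noOvercondensation (v : ℝ → ℝ≥0∞) {ρ₁ : ℝ} (hρ₁ : 0 < ρ₁)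
    (H : ∀ ρ : ℝ, 0 < ρ → ρ < ρ₁ → ∀ τ : ℝ, 0 < τ → ∃ κ : ℝ, 0 < κ ∧ ∀ᶠ N : ℕ in atTop,
      groundStateEnergy v N (sideLength ρ N) ≠ ⊤ → ∃ n : ℝ≥0∞,
        (∀ δ : ℝ≥0∞, 0 < δ → ∃ Ψ : TrialState N (sideLength ρ N),
          energy v Ψ ≤ groundStateEnergy v N (sideLength ρ N) + δ ∧ n ≤ maxOccupation N Ψ.ψ + δ) ∧
        ∀ Ψ : TrialState N (sideLength ρ N),
          energy v Ψ ≤ groundStateEnergy v N (sideLength ρ N) +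
              ENNReal.ofReal (κ / sideLength ρ N ^ 2) * N →
            maxOccupation N Ψ.ψ ≤ n + ENNReal.ofReal (τ * N)) :
    ∃ ρ₁ : ℝ, 0 < ρ₁ ∧ ∀ ρ : ℝ, 0 < ρ → ρ < ρ₁ → ∀ τ : ℝ, 0 < τ → ∃ κ : ℝ, 0 < κ ∧
      ∀ᶠ N : ℕ in atTop, ∀ lam : ℝ, 0 < lam → lam ≤ κ / sideLength ρ N ^ 2 →
        (⨅ Ψ : TrialState N (sideLength ρ N),
              energy v Ψ + ENNReal.ofReal lam * ((N : ℝ≥0∞) - maxOccupation N Ψ.ψ)) +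
            ENNReal.ofReal (lam / (κ / sideLength ρ N ^ 2)) * groundStateEnergy v N (sideLength ρ N) ≤
          groundStateEnergy v N (sideLength ρ N) +
              ENNReal.ofReal (lam / (κ / sideLength ρ N ^ 2)) *
                (⨅ Ψ : TrialState N (sideLength ρ N), energy v Ψ +
                  ENNReal.ofReal (κ / sideLength ρ N ^ 2) * ((N : ℝ≥0∞) - maxOccupation N Ψ.ψ)) +
            ENNReal.ofReal (lam * τ * N) := by
  refine ⟨ρ₁, hρ₁, fun ρ hρ hlt τ hτ => ?_⟩
  obtain ⟨κ, hκ, hev⟩ := H ρ hρ hlt τ hτ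
  refine ⟨κ, hκ, ?_⟩
  filter_upwards [hev] with N hN lam hlam hle
  by_cases hE : groundStateEnergy v N (sideLength ρ N) = ⊤
  · rw [hE, top_add, top_add]
    exact le_top
  obtain ⟨n, hnear, hwin⟩ := hN hE
  exact twoChord_of_noOvercondensation n hlam hle hnear hwin

end Summit.AtomisticToContinuum.BoseEinsteinCondensation.ModeFreeReward

end
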